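import Summits.QuantumFields.YangMills.Theorems.FluctuationComparisonRegPrIntLS2BetaResidualGauge
import Literature.MathematicalPhysics.QuantumFieldTheory.Balaban1983to89.T3SectALandauChart
import HarnessLib

/-!
# S2β · GAP♯∘ — (RES-u.1) «THE SPLIT `u = ǔ·r`» and (RES-u.0, lane side) «THE DEFECT IDENTITY»: every fine gauge transformation is the LIFT of its own descent times a
# RESIDUAL one, and a Thm-2-type representative `u⁻¹•U = E·U₀` of a fibre pair `(U₀, U)` over `V` descends to `D(E·U₀) = (u↓)⁻¹ • V`

Cell `ym3-torus` (rung R3 = continuum `SU(2)` YM₃ on T³ at fixed lattice data — NOT d = 4, NOT infinite volume, NOT a mass gap, NOT Clay).  Width seat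
`ym3-torus-px16` (gen 24); crux `stmt-QuantumFields-20520` `FluctuationComparisonRegPrIntL`, LINE g18-1 S2β (registry untouched); organ GAP♯∘; (RES-u) of record
(architect px17 g23 2026-09-01T01:09Z, desk №704): [Balaban1985RegularSpaces] Thm 2's (1.29)-restricted gauge `u` is NOT residual (px16 byte-check 00:43Z), so the
knit moves the GAP♯∘ triple by `u = ǔ·r` — `ǔ := liftTransfTo (u↓)` the lift of the descent `u↓ = descTransf u` (door ✓∕⧗`…S2BetaBodyRebaseTriple`), `r := ǔ⁻¹·u`
RESIDUAL (door ✓∕⧗`…S2BetaBodyRebaseResidual`).  THIS FILE supplies the two facts the doors are applied with: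
* §1 (RES-u.1) ★`residual_liftDesc_inv_mul (u)`: `r := (liftTransfTo (descTransf u))⁻¹ · u` is residual (`r↓ = (u↓)⁻¹·u↓ = 1`, lit ✓`descTransf_mul`∕✓`descTransf_inv`∕
  ✓`descTransf_liftTransfTo`, then ✓`residual_of_descTransf_eq_one`), and `u = ǔ·r` pointwise (`split_liftDesc`);
* §2 (RES-u.0, lane side) ★`descendTo_rep_eq (hrep : u⁻¹•U = E·U₀) (hU : U ∈ fibre V) : D_{J,K}(E·U₀) = (u↓)⁻¹ • V` (lit ✓`descendTo_gaugeAct` + ✓`descTransf_inv`) —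
  the «defect identity» of desk №704 at the level of the lane's descent: the Thm-2 representative's twisted background descends to the `(u↓)⁻¹`-MOVED datum, so
  `t := u↓ = transfUp u (K−J)` is a stabiliser of `V` exactly up to the descent of the twist `E` (print: `e^{iB}`, `‖B‖ < 2dLα₁`, (1.37) — the identification of
  `D_{J,K}(E·U₀)` with `e^{iB}·V` is the B7 covariant-average dictionary (`dbavgCov`∕`logCovIter` ↔ `blockAvg ℰp`), NOT on the tree and NOT claimed here).
`--kind proof --supports stmt-QuantumFields-20520 --as helper`, count-neutral, DEFINITION-FREE (0 `def`, 0 `instance`, 0 `sorry`; default heartbeats).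

HONEST.  Group bookkeeping over landed lemmas; the torus reading of `Concl2Setup`'s `mgauge … = cfgExp η (pull A 0)` as `u⁻¹•U = E·U₀` (hypothesis `hrep` here) is the
(R-3) lineage's dictionary (px13 g29 FILE 2), the `e^{iB}` identification is OPEN (above), (RES-u.4)∕(REG)∕«GAUGE-REP»∕hsupp∕hD∕hDBX are OPEN ∕ HYPOTHESES; nothing of
Bałaban's analysis asserted ([Balaban1985Averaging] (11)–(13) p.19; [Balaban1985Variational] (4) p.278; [Balaban1985RegularSpaces] (1.29) p.81, (1.37) p.82); GAP♯∘
(`stub_uniformFibreGapOrbit`, 0∕5), the five REGISTERED stubs, S2β, crux 20520, 19936, 19200, `YM3TorusSU2` NOT proved; rung R3 = SU(2) YM₃ on T³ — NOT d = 4, NOT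
infinite volume, NOT a mass gap, NOT Clay; the Yang–Mills mass gap is NOT proved.
-/

set_option autoImplicit false

noncomputable section

namespace Summit.QuantumFields.YangMills.Theorems.FluctuationComparisonRegPrIntLS2BetaThm2GaugeSplitResidual

open Literature.MathematicalPhysics.QuantumFieldTheory.Balaban1983to89
open T4Continuum T3ContinuumYM3Torus T3UnitScaleTilt T3TiltDescent T3LevelShift
open T3UnitLawDensityEML (ℰp)
open T3ConstrainedMinimiser (fibre)
open T3PrintedRegularOrbits (liftTransfTo descTransf descTransf_liftTransfTo descendTo_gaugeAct)
open T3SectALandauChart (descTransf_inv descTransf_mul)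
open Summit.QuantumFields.YangMills.Theorems.FluctuationComparisonRegPrIntLS2BetaResidualGauge (residual_of_descTransf_eq_one gaugeAct_mul_eq)

variable (F : T3Family) {J K : ℕ} (hJK : J ≤ K)

/-! ## §1 (RES-u.1) The split `u = ǔ·r`, `r` residual -/

/-- ★ **`r := (liftTransfTo (u↓))⁻¹ · u` IS RESIDUAL** for every fine gauge transformation `u` (`r↓ = (u↓)⁻¹·(u↓) = 1`).
[cite: Balaban1985Averaging, (11)-(13) p.19; Balaban1985Variational, (4) p.278] -/
theorem residual_liftDesc_inv_mul (u : Site (F.P K) 0 → Matrix.specialUnitaryGroup (Fin 2) ℂ) :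
    ∀ U : GaugeField (F.P K) 0 (Matrix.specialUnitaryGroup (Fin 2) ℂ),
      descendTo F ℰp J K hJK
          (GaugeField.gaugeAct (fun x => (liftTransfTo F J K hJK (descTransf F J K hJK u) x)⁻¹ * u x) U) =
        descendTo F ℰp J K hJK U := by
  refine residual_of_descTransf_eq_one F hJK ?_
  rw [descTransf_mul, descTransf_inv, descTransf_liftTransfTo]
  funext x
  exact inv_mul_cancel _

/-- `u = ǔ · r` pointwise, `ǔ := liftTransfTo (u↓)`, `r := ǔ⁻¹·u`. [folklore] -/
theorem split_liftDesc (u : Site (F.P K) 0 → Matrix.specialUnitaryGroup (Fin 2) ℂ) :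
    u = fun x => liftTransfTo F J K hJK (descTransf F J K hJK u) x * ((liftTransfTo F J K hJK (descTransf F J K hJK u) x)⁻¹ * u x) := by
  funext x
  rw [mul_inv_cancel_left]

/-- The corresponding factorisation of the ACTION: `u•X = ǔ•(r•X)`. [cite: Balaban1985Averaging, (8) p.19] -/
theorem gaugeAct_split_liftDesc (u : Site (F.P K) 0 → Matrix.specialUnitaryGroup (Fin 2) ℂ) (X : GaugeField (F.P K) 0 (Matrix.specialUnitaryGroup (Fin 2) ℂ)) :
    GaugeField.gaugeAct u X =
      GaugeField.gaugeAct (liftTransfTo F J K hJK (descTransf F J K hJK u))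
        (GaugeField.gaugeAct (fun x => (liftTransfTo F J K hJK (descTransf F J K hJK u) x)⁻¹ * u x) X) := by
  rw [← gaugeAct_mul_eq]
  congr 1
  exact split_liftDesc F hJK u

/-! ## §2 (RES-u.0, lane side) The defect identity at the level of the descent -/

/-- ★ **THE DEFECT IDENTITY (lane side)**: if `u⁻¹•U = E·U₀` bondwise and `U` lies over `V`, then the twisted background descends to the MOVED datum:
`D_{J,K}(E·U₀) = (u↓)⁻¹ • V`.  So `u↓` stabilises `V` exactly up to the descent of the twist. [cite: Balaban1985Averaging, (11)-(13) p.19; Balaban1985RegularSpaces, (1.37) p.82] -/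
theorem descendTo_rep_eq (u : Site (F.P K) 0 → Matrix.specialUnitaryGroup (Fin 2) ℂ)
    (E U₀ U : GaugeField (F.P K) 0 (Matrix.specialUnitaryGroup (Fin 2) ℂ)) {V : GaugeField (F.P J) 0 (Matrix.specialUnitaryGroup (Fin 2) ℂ)}
    (hrep : GaugeField.gaugeAct (fun x => (u x)⁻¹) U = fun b => E b * U₀ b) (hU : U ∈ fibre F ℰp J K hJK V) :
    descendTo F ℰp J K hJK (fun b => E b * U₀ b) = GaugeField.gaugeAct (fun x => (descTransf F J K hJK u x)⁻¹) V := by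
  have hV : descendTo F ℰp J K hJK U = V := hU
  rw [← hrep, descendTo_gaugeAct, descTransf_inv, hV]

/-- The same with `U₀` also over `V` displayed as a defect: `D_{J,K}(E·U₀) = (u↓)⁻¹ • D_{J,K}(U₀)` — the twist's descent measures how far `u↓` is from
stabilising the common datum. [cite: Balaban1985Averaging, (11)-(13) p.19; Balaban1985RegularSpaces, (1.37) p.82] -/
theorem descendTo_rep_eq' (u : Site (F.P K) 0 → Matrix.specialUnitaryGroup (Fin 2) ℂ)
    (E U₀ U : GaugeField (F.P K) 0 (Matrix.specialUnitaryGroup (Fin 2) ℂ)) {V : GaugeField (F.P J) 0 (Matrix.specialUnitaryGroup (Fin 2) ℂ)}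
    (hrep : GaugeField.gaugeAct (fun x => (u x)⁻¹) U = fun b => E b * U₀ b) (hU : U ∈ fibre F ℰp J K hJK V) (hU₀ : U₀ ∈ fibre F ℰp J K hJK V) :
    descendTo F ℰp J K hJK (fun b => E b * U₀ b) = GaugeField.gaugeAct (fun x => (descTransf F J K hJK u x)⁻¹) (descendTo F ℰp J K hJK U₀) := by
  have hV₀ : descendTo F ℰp J K hJK U₀ = V := hU₀
  rw [hV₀]
  exact descendTo_rep_eq F hJK u E U₀ U hrep hU

/-- ★ **AFTER THE RESIDUAL HALF IS ABSORBED**: moving `U` by `ǔ⁻¹` alone (the lift of `(u↓)⁻¹`) ALSO lands over `(u↓)⁻¹ • V` — the residual factor is invisible to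
the descent — so the triple door is applied with the coarse transformation `(u↓)⁻¹` and the residual door with `r`. [cite: Balaban1985Averaging, (11)-(13) p.19] -/
theorem descendTo_gaugeAct_liftDesc_inv (u : Site (F.P K) 0 → Matrix.specialUnitaryGroup (Fin 2) ℂ)
    (U : GaugeField (F.P K) 0 (Matrix.specialUnitaryGroup (Fin 2) ℂ)) {V : GaugeField (F.P J) 0 (Matrix.specialUnitaryGroup (Fin 2) ℂ)} (hU : U ∈ fibre F ℰp J K hJK V) :
    descendTo F ℰp J K hJK (GaugeField.gaugeAct (fun x => (liftTransfTo F J K hJK (descTransf F J K hJK u) x)⁻¹) U) =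
      GaugeField.gaugeAct (fun x => (descTransf F J K hJK u x)⁻¹) V := by
  have hV : descendTo F ℰp J K hJK U = V := hU
  rw [descendTo_gaugeAct, descTransf_inv, descTransf_liftTransfTo, hV]

end Summit.QuantumFields.YangMills.Theorems.FluctuationComparisonRegPrIntLS2BetaThm2GaugeSplitResidual

end
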